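import Summits.BirchSwinnertonDyer.Rank1Residual.Additive.SpecialJTraceForm1728
import HarnessLib

/-!
# `j = 1728` over `𝔽_p`: the trace is `C((p−1)/2, (p−1)/4)·(−c₄/48)^{(p−1)/4}` modulo `p`

HONEST FRAMING (cell `b2b-bsdres`, run/shared/lean/b2b/bsd-rank1-residual/, verbatim in every
file): the goal of the cell is to DELETE the COMBINATION-SHAPED residual classes of the
Birch–Swinnerton-Dyer formula for ALL analytic-rank `≤ 1` elliptic curves over `ℚ` — "full BSD
formula for every rank `≤ 1` curve in class `C`" assembled STRICTLY from published theorems — so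
that the rank-`≤ 1` remainder becomes exactly the CONSTRUCTION-SHAPED classes, which are TYPED
(missing-input `Prop`s), NOT attempted. This is not "finishing BSD". Sub-cell `additive-p2`
(X3♯(G-ord) / X4♯(G-ord)), generation 35, part 4: research route; no claim beyond the stated
classes; theorems only, no definition, no named fact, nothing booked, no label moved.

## What is proved

The Hasse-invariant congruence for `j = 1728` in the curve's own invariant `c₄` (gen 3's Euler
criterion `intCast_trace_eq_neg_sum_pow` + `sum_pow_cubic_of_a₆_eq_zero` on the short model
`y² = x³ + a₄x`, `a₄ = −c₄/48`, transported to an arbitrary model: `c₄` changes by `u⁻⁴` and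
`(u⁻⁴)^{(p−1)/4} = u^{−(p−1)} = 1` in a field with `p` elements):

* **`SpecialJ.intCast_trace_eq_choose_mul_pow_of_j_eq`** — `E` elliptic over a field `k` with a prime
  number `p ≡ 1 (mod 4)` of elements, `j(E) = 1728`:
  **`p + 1 − #E(k) ≡ C((p−1)/2, (p−1)/4) · (−c₄(E)/48)^{(p−1)/4}` in `k`** (Silverman *AEC* V.4.1(a);
  with part 1's `a = 2u`, `u² + v² = p` this is Gauss's congruence `C(2n, n) ≡ 2a (mod p)`,
  `p = 4n + 1 = a² + b²`, read on the curve). Since the candidates `±2u, ±2v` are pairwise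
  incongruent modulo `p`, the residue PINS the trace: the trace of a `j = 1728` curve over `𝔽_p` is a
  function of `p` and the class of `c₄` in `𝔽_p^× / 𝔽_p^{×4}` (evidence LAW 6 of gen 35's reading:
  32/32 defect-`4` census rows at `p ≥ 13`, 233/233 at `p = 5` where it reads `a ≡ c₄`).

References: C. F. Gauss, *Theoria residuorum biquadraticorum* I (1828); K. Ireland, M. Rosen, GTM 84,
Ch. 18 §4; J. H. Silverman, *AEC* V.4.1(a), Ex. V.4.5; L. C. Washington, *Elliptic Curves* §4.6.
-/

noncomputable section

open scoped Classical

open WeierstrassCurve Literature.NumberTheory.EllipticCurves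

namespace Summit.BirchSwinnertonDyer.Rank1Residual.Additive

namespace SpecialJ

variable {k : Type*} [Field k] [Finite k] (E : WeierstrassCurve k) [E.IsElliptic] {p : ℕ}

/-- **The trace of a `j = 1728` curve over `𝔽_p` modulo `p`, in terms of `c₄`.** For an elliptic
curve `E` over a field `k` with a prime number `p ≡ 1 (mod 4)` of elements and `j(E) = 1728`:
`p + 1 − #E(k) = C((p−1)/2, (p−1)/4)·(−c₄(E)/48)^{(p−1)/4}` in `k`. On the short model
`y² = x³ + a₄x` (`a₄ = −c₄/48`) this is Euler's criterion applied to `Σ_x (x³ + a₄x)^{(p−1)/2}` (only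
the monomial `x^{p−1}` survives; gen 3's `sum_pow_cubic_of_a₆_eq_zero`); `(−c₄/48)^{(p−1)/4}` is a
model invariant because `c₄ ↦ u⁻⁴c₄` and `u^{p−1} = 1`. Silverman *AEC* V.4.1(a) (`a ≡` Hasse
invariant); Gauss's `C(2n, n) ≡ 2a (mod p)`. [cite: IrelandRosen1990, Ch. 18 §4, Theorem 5] -/
theorem intCast_trace_eq_choose_mul_pow_of_j_eq (hp : p.Prime) (hp1 : p % 4 = 1)
    (hcard : Nat.card k = p) (hj : E.j = 1728) :
    (((p : ℤ) + 1 - Nat.card E.toAffine.Point : ℤ) : k) =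
      ((((p - 1) / 2).choose ((p - 1) / 4) : ℕ) : k) * (-E.c₄ / 48) ^ ((p - 1) / 4) := by
  haveI := Fintype.ofFinite k
  haveI : Fact p.Prime := ⟨hp⟩
  obtain ⟨hchar, hq⟩ := ringChar_eq_of_natCard_eq (k := k) hp hcard
  have hp5 : 5 ≤ p := GaussianQuartic.five_le hp1
  obtain ⟨h2, h3⟩ := ringChar_ne_two_and_ne_three (F := k) hchar hp5
  obtain ⟨h2', h3'⟩ := two_ne_zero_and_three_ne_zero h2 h3
  haveI : Invertible (2 : k) := invertibleOfNonzero h2'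
  haveI : Invertible (3 : k) := invertibleOfNonzero h3'
  set C := E.toShortNF with hC
  haveI : (C • E).IsShortNF := E.toShortNF_spec
  have hjS : (C • E).j = 1728 := by rw [variableChange_j, hj]
  have hc6 : (C • E).c₆ = 0 := (j_eq_iff_c₆_eq_zero _).mp hjS
  have h48 : (48 : k) ≠ 0 := by
    rw [show (48 : k) = 2 ^ 4 * 3 by norm_num]
    exact mul_ne_zero (pow_ne_zero _ h2') h3'
  have ha6 : (C • E).a₆ = 0 := by
    rw [(C • E).c₆_of_isShortNF] at hc6
    have h864 : (-864 : k) ≠ 0 := by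
      rw [show (-864 : k) = -(2 ^ 5 * 3 ^ 3) by norm_num]
      exact neg_ne_zero.mpr (mul_ne_zero (pow_ne_zero _ h2') (pow_ne_zero _ h3'))
    exact (mul_eq_zero.mp hc6).resolve_left h864
  -- Euler's criterion on the short model
  have hdiv2 : Fintype.card k / 2 = (p - 1) / 2 := by rw [hq]; omega
  have hdiv4 : (Fintype.card k - 1) / 4 = (p - 1) / 4 := by rw [hq]
  have hexp : (p - 1) / 2 - (p - 1) / 4 = (p - 1) / 4 := by omega
  have htr : ((((Fintype.card k : ℤ) + 1 - Nat.card (C • E).toAffine.Point : ℤ)) : k) =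
      ((((p - 1) / 2).choose ((p - 1) / 4) : ℕ) : k) * (C • E).a₄ ^ ((p - 1) / 4) := by
    rw [intCast_trace_eq_neg_sum_pow (C • E) h2,
      sum_pow_cubic_of_a₆_eq_zero (C • E) h2 ha6 (by rw [hq]; omega), neg_neg, hdiv2, hdiv4, hexp]
  -- `a₄ = -c₄/48` on the short model, `c₄(C • E) = u⁻⁴ c₄(E)`, and `u^{p-1} = 1`
  have ha4 : (C • E).a₄ = -(C • E).c₄ / 48 := by
    rw [(C • E).c₄_of_isShortNF]; field_simp
  have hw : ((C.u⁻¹ : kˣ) : k) ^ (p - 1) = 1 := by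
    have h := FiniteField.pow_card_sub_one_eq_one ((C.u⁻¹ : kˣ) : k) (Units.ne_zero _)
    rwa [hq] at h
  have hpow : (C • E).a₄ ^ ((p - 1) / 4) = (-E.c₄ / 48) ^ ((p - 1) / 4) := by
    rw [ha4, variableChange_c₄,
      show -(((C.u⁻¹ : kˣ) : k) ^ 4 * E.c₄) / 48 = ((C.u⁻¹ : kˣ) : k) ^ 4 * (-E.c₄ / 48) by ring,
      mul_pow, ← pow_mul, show 4 * ((p - 1) / 4) = p - 1 by omega, hw, one_mul]
  rw [Nat.card_congr (VariableChange.pointEquiv E C).toEquiv, ← hpow, ← htr, hq]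

end SpecialJ

end Summit.BirchSwinnertonDyer.Rank1Residual.Additive

end
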